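import Summits.QuantumFields.YangMills.Theorems.BalabanUVNodesN16RegimeDefs
import Literature.MathematicalPhysics.QuantumFieldTheory.Balaban1983to89.Node00.Record11CarriersB8
import HarnessLib

/-!
# Route «BalabanUVNodes», cluster K4 «SpineRates» — node N16 = NE3 AT NODE 00's STAGE-11 RECORD: a RECORD CENSUS.  (§1) the K4 stub `S_N16` at every
# rate-record predicate KEYED FUNCTIONALLY TO `Stage11Params` (the RATE-RECORD HOME's shape, dag-lead WORDS-99) — `Iff` face + ONE-APPLICATION knit + N21's
# face; (§2) «b8 → b11 → NE3» at the five-pin record `IsRecordOfRecord₁₁CB10YZWB8` MODULO ONE displayed dictionary; (§3) the JUNK TESTS: what a home must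
# pin of `R.ne3` (a refuting bundle, the record-ALONE key, the tautological and flat homes closing K4's `S_R00x ∧ S_N16` with no content)

Cell `pub-ymgap`, seat `pub-ymgap-dag-n16-e` (R134 acceleration seat (a), strategy s2 = BY-NAME KNIT at the ₁₁ record; HUMAN RULING D-0062; chair R424 venue),
generation 0, file 2 of 2 (THEOREMS ONLY, 0 `def`, 0 `sorry`); file 1 `BalabanUVNodesN16RegimeDefs` names THE END's regime (`PrintSlot`, `radiusOfRecord`,
`constOfRecord`, `InEndRegime`, `n16At_of_inEndRegime_printSlot`).  `bears_on: R4∕N16 · K3 SpineGivenEndpointR11`.  Filed `--supports stmt-QuantumFields-19676`.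
Pattern: dag-n14-d's `BalabanUVNodesN14RecordCensus` (p-landed today) transposed to N16 with N16's OWN refuting carrier, as that seat invited (INBOX l.12122).

THE SITUATION (reproducible; = n22-e LOCATED-1, n14-d LOCATED-S2, RR-2 PRE-READ §C item 2).  `S_N16 RRec := ∀ F D g₀ os R, RRec F D g₀ os R → N16At R.ne3`
(module 2) over the PARAMETER `RRec : RateRecordPred N`; the home `RRec₁₁` keyed to `Node00/Record11` is being typed NOW in two layers (RR-1 layer A
`Node00/RateRecord11.lean`: `IsRateKey₁₁ F N D w θ`, `NE3Objects₁₁`; n22-e layer B `Thm/…RateCarriersOfRecord11`: `ne3OfRecord₁₁ F o := ⟨F.L, o.Nper, …⟩`, `RRec₁₁ 𝔯 𝔱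
:= fun F D g₀ os R => ∃ θ w k, IsRateKey₁₁ F N D w θ ∧ R = ⟨…, ne3OfRecord₁₁ F (𝔯 F θ g₀ os).ne3, …⟩` over a RESIDUAL ASSIGNMENT `𝔯` pinned later by name).  This file
states N16's side for EVERY home of that shape, with the home's objects as PARAMETERS (`K`, `ne3Of`) — so it applies verbatim the hour layer B lands (dag-lead:
«keep the parametric binder until then») — and records in the kernel what such a home must pin of `R.ne3` for `S_N16` to carry content.

CONTENT.
§1 AT A `Stage11Params`-KEYED HOME (`K : ∀ F, Datum F N → Stage11Params F N → Prop`, `ne3Of : ∀ F, Stage11Params F N → (ℕ → ℝ) → List (ULoop F) → NE3Carriers N`;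
the home ADMITS `R` only with `R.ne3 = ne3Of F θ g₀ os` at a keyed `θ`, and ATTAINS every keyed `θ`'s bundle): `s_N16_keyed_iff` — `S_N16 RRec ↔ ∀ F D θ, K F D θ →
∀ g₀ os, N16At (ne3Of F θ g₀ os)`; **`s_N16_keyed_of_inEndRegime_printSlot`** — THE ONE-APPLICATION KNIT: `S_N16 RRec` from, at every keyed `θ`, the PROVISO
`InEndRegime (ne3Of F θ g₀ os)` (the home displays it; RR-2: «the home cannot close it and must not assert it») and the CONTENT `PrintSlot (ne3Of F θ g₀ os)` (N05's
[Balaban1985RegularSpaces] Theorem 4 at the bundle's pairs + N07's [Balaban1985Variational] Thm 1 (8)+(10) — proved nowhere in the tree);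
`n16At_keyed_of_familyL` — the same per bundle with `(ne3Of …).L = F.L` (layer B's `ne3OfRecord₁₁`), the block-factor clause being the family's;
`covRoot_keyed` — N21's face (`…N21ClosenessAtRecord` reads `S_N16` through `covRoot_at_record`) at the keyed bundle.
§2 AT THE FIVE-PIN RECORD `IsRecordOfRecord₁₁CB10YZWB8` — `leaves_b8_b11_of_isRecordOfRecord₁₁CB10YZWB8` (projection of g31's `leaves_iff_of_…`: `b8 ↔ B8LeafOfRecord
θ₃ lam`, `b11 ↔ B11Leaf (Z11OfRecord F N ζ)` for the presenting package) and **`n16At_at_record₁₁CB8_of_dictionary`**: if the record's `b8`, `b11` leaves hold at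
some run, every bundle `c` with `c.L = F.L` in THE END's regime satisfies `N16At c` PROVIDED the displayed DICTIONARY (D): for every presenting package,
`B8LeafOfRecord θ₃ lam → B11Leaf (Z11OfRecord F N ζ) → PrintSlot c`.  (D) is N16's two in-edges AT THE RECORD's OBJECTS — its Theorem-4 half is INTERFACE-GAP-1
(record's [B8] group on the `ℤ^{θ.D}` family `famB8OfRecord`, coefficients `θ.𝔸`; N16 reads `Thm4TorusAt` over `Matrix (Fin N) (Fin N) ℂ` — n16-c's periodicity
principle `…N16Thm4TorusOfZd` is its first brick), its `LeafH3sup` half is [Balaban1985Variational] Thm 1 (8)+(10) on `Z11OfRecord` versus the `B7Prop1Explicit`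
minimisers — a HYPOTHESIS, NOT in the tree, NOT asserted.
§3 THE JUNK TESTS [decided toys; degenerate probes of the typing, nothing of Bałaban's asserted or denied] — `n16At_anti_dom` (smaller `dom` ⇒ weaker);
`n16At_of_dom_empty` (EMPTY admissible data close `N16At` vacuously); **`not_n16At_flatStratum_negLip`** (THE REFUTING CARRIER: the flat-stratum bundle with
covariant-Lipschitz letter `Λ₁ = −1` violates `N16At` — the flat datum HAS regular minimisers at every level (`NE7EtaBackgroundFlatStratum.hmin_flatStratum`) and no
direction `Z` has a norm below `−ξ²`); `not_s_N16_of_admits_negLip`; **`s_N16_recordKey_iff_empty`** (for EVERY `Rec : RecordPred N`: `S_N16` keyed to the record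
ALONE ↔ the record class is EMPTY), `not_s_N16_record₁₁C` ∕ `not_s_N16_record₁₁C_two` (FALSE at `IsRecordOfRecord₁₁C` given inhabitation; at `N = 2` the
hypothesis is K0 `Record11Inhabited`'s text verbatim — K0 and a record-ALONE-keyed `S_N16` are jointly inconsistent); **`n16Key₁₁_closes_R00x_and_N16`**,
**`flatKey₁₁_closes_R00x_and_N16`** (THE JUNK HOMES: «₁₁C record ∧ `N16At R.ne3`» and «₁₁C record ∧ `R.ne3` = the flat-stratum bundle at `(F.L, 1)`» close BOTH
K4's existence stub `S_R00x Rec₁₁C` AND `S_N16` — by the empty-data ∕ flat bundles: a home that does not pin `R.ne3.dom` to THE DATA THE CONSUMERS N19∕N21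
QUANTIFY OVER carries no content at N16's corner; R422 for K4's N16 in the kernel).

HONEST FRAMING.  Kernel bookkeeping by name over module 2, file 1, n16-a's files 5∕14, g31∕def-T's record modules and the flat-stratum support files; no
estimate; `S_N16` is NOT proved for any home of record (none has landed; its content `PrintSlot` is N05's∕N07's theorems, unproved in the tree); **N16 ∕ NE3 is NOT
discharged**; count-neutral; one finite four-torus at fixed ε — NOT ℝ⁴, NOT infinite volume, NOT OS, NOT a mass gap, NOT Clay.
-/

set_option autoImplicit false

open scoped BigOperators Matrix Matrix.Norms.L2Operator
open NormedSpace

namespace Summit.QuantumFields.YangMills.BalabanUVNodes.N16AtRecord11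

open Literature.MathematicalPhysics.QuantumFieldTheory.Balaban1983to89
open Literature.MathematicalPhysics.QuantumFieldTheory.Balaban1983to89.T4Continuum (T4Family ULoop FiniteEpsData)
open B7Prop1Explicit B7Prop2Explicit
open T4AveragingDeficitWallBoundary (IsPeriodicCfg)
open DagBinding (WorldP leavesP B11Leaf)
open Node00 (IsRecordOfRecord₁₁C IsRecordOfRecord₁₁CB10YZWB8 Stage11Params ResidB8 ResidZ B8LeafOfRecord Z11OfRecord
  leaves_iff_of_isRecordOfRecord₁₁CB10YZWB8)
open Summit.QuantumFields.BalabanUV.T4Continuum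
open MinimalActionRate (sfClass)
open MinimalActionRefine (gradConst)
open MinimalActionWitness (flatCfg)
open NE3EnergyShapes (IsUnitarySite)
open NE3EnergyWeightedCovShape (NE3EnergyRateWCov)
open NE7EtaBackgroundFlatStratum (hmin_flatStratum flatCfg_mem_flatStratum)
open NE1p.DressedRoot (growingTower)
open YMDAG.UVSplit (Datum RecordPred NE3Carriers RateCarriers RateRecordPred N16At S_N16 S_R00x)
open Summit.QuantumFields.YangMills.BalabanUVNodes.N16AtRecord (n16At_flatStratum covRoot_at_record)
open Summit.QuantumFields.YangMills.BalabanUVNodes.N16Regime (PrintSlot InEndRegime radiusOfRecord constOfRecord n16At_of_inEndRegime_printSlot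
  inEndRegime_iff_of_familyL)

noncomputable section

variable {N : ℕ} [NeZero N]

/-! ## §1 AT A `Stage11Params`-KEYED HOME: the stub read, the one-application knit, N21's face -/

section Keyed

variable {K : ∀ F : T4Family, Datum F N → Stage11Params F N → Prop}
  {ne3Of : ∀ F : T4Family, Stage11Params F N → (ℕ → ℝ) → List (ULoop F) → NE3Carriers N} {RRec : RateRecordPred N}

/-- **WHAT `S_N16` SAYS AT A `Stage11Params`-KEYED HOME** (`Iff`): if the home ADMITS a bundle `R` at `(F, D, g₀, os)` only with `R.ne3 = ne3Of F θ g₀ os` for a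
keyed `θ` (`K F D θ`), and conversely every keyed `θ`'s NE3 bundle is ATTAINED by an admitted `R`, then `S_N16 RRec` IS «at every keyed `θ`, N16 at the home's NE3
bundle».  Both hypotheses hold by `rfl`-unpacking for layer B's `RRec₁₁ 𝔯 𝔱` (key `∃ w, IsRateKey₁₁ F N D w θ`, `ne3Of F θ g₀ os := ne3OfRecord₁₁ F (𝔯 F θ g₀ os).ne3`,
any level `k` as the attained bundle). [folklore] -/
theorem s_N16_keyed_iff
    (hadm : ∀ (F : T4Family) (D : Datum F N) (g₀ : ℕ → ℝ) (os : List (ULoop F)) (R : RateCarriers N), RRec F D g₀ os R →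
      ∃ θ : Stage11Params F N, K F D θ ∧ R.ne3 = ne3Of F θ g₀ os)
    (hatt : ∀ (F : T4Family) (D : Datum F N) (θ : Stage11Params F N), K F D θ → ∀ (g₀ : ℕ → ℝ) (os : List (ULoop F)),
      ∃ R : RateCarriers N, RRec F D g₀ os R ∧ R.ne3 = ne3Of F θ g₀ os) :
    S_N16 RRec ↔ ∀ (F : T4Family) (D : Datum F N) (θ : Stage11Params F N), K F D θ → ∀ (g₀ : ℕ → ℝ) (os : List (ULoop F)), N16At (ne3Of F θ g₀ os) := by
  constructor
  · intro h F D θ hθ g₀ os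
    obtain ⟨R, hR, hne3⟩ := hatt F D θ hθ g₀ os
    rw [← hne3]
    exact h F D g₀ os R hR
  · intro h F D g₀ os R hR
    obtain ⟨θ, hθ, hne3⟩ := hadm F D g₀ os R hR
    rw [hne3]
    exact h F D θ hθ g₀ os

/-- **THE ONE-APPLICATION KNIT AT A `Stage11Params`-KEYED HOME**: `S_N16 RRec` as soon as, at every keyed `θ`, the home's NE3 bundle satisfies the PROVISO
`InEndRegime` (displayed by the home — RR-2: «the home cannot close it and must not assert it») and carries the CONTENT `PrintSlot` (N05's Theorem 4 at the
bundle's pairs + N07's `LeafH3sup`, the two in-edges).  Only the ADMIT half of the key is used. [folklore] -/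
theorem s_N16_keyed_of_inEndRegime_printSlot
    (hadm : ∀ (F : T4Family) (D : Datum F N) (g₀ : ℕ → ℝ) (os : List (ULoop F)) (R : RateCarriers N), RRec F D g₀ os R →
      ∃ θ : Stage11Params F N, K F D θ ∧ R.ne3 = ne3Of F θ g₀ os)
    (hreg : ∀ (F : T4Family) (D : Datum F N) (θ : Stage11Params F N), K F D θ → ∀ (g₀ : ℕ → ℝ) (os : List (ULoop F)), InEndRegime (ne3Of F θ g₀ os))
    (hslot : ∀ (F : T4Family) (D : Datum F N) (θ : Stage11Params F N), K F D θ → ∀ (g₀ : ℕ → ℝ) (os : List (ULoop F)), PrintSlot (ne3Of F θ g₀ os)) :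
    S_N16 RRec := by
  intro F D g₀ os R hR
  obtain ⟨θ, hθ, hne3⟩ := hadm F D g₀ os R hR
  rw [hne3]
  exact n16At_of_inEndRegime_printSlot (hreg F D θ hθ g₀ os) (hslot F D θ hθ g₀ os)

omit [NeZero N] in
/-- **N16 AT ONE KEYED BUNDLE WHOSE BLOCK FACTOR IS THE FAMILY's** (layer B's `ne3OfRecord₁₁ F o := ⟨F.L, o.Nper, …⟩`): the proviso without its first clause
(`2 ≤ F.L` is `HistoryFlow.two_le_L`) and the slot give `N16At`. [folklore] -/
theorem n16At_keyed_of_familyL [NeZero N] {F : T4Family} {c : NE3Carriers N} (hL : c.L = F.L)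
    (hreg : 1 ≤ c.Nper ∧ 0 < c.g ∧ 0 < c.ε ∧ c.ε ≤ radiusOfRecord N F.L c.Nper ∧ 0 ≤ c.Λ₁ ∧ c.Λ₁ ≤ radiusOfRecord N F.L c.Nper ∧
      0 ≤ c.b ∧ c.b ≤ c.ε / 2 ∧ constOfRecord N F.L c.Nper c.g ≤ c.C)
    (hslot : PrintSlot c) : N16At c :=
  n16At_of_inEndRegime_printSlot ((inEndRegime_iff_of_familyL hL).2 hreg) hslot

/-- **N21's FACE AT A `Stage11Params`-KEYED HOME** — under `S_N16 RRec`, at every keyed `θ` the covariant root `NE3EnergyRateWCov 4 (sfClass 4 c.L c.Nper c.ε) …`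
holds at `c := ne3Of F θ g₀ os` (what `…N21ClosenessAtRecord` reads as `hcov`, through any admitted `R` attaining the bundle). [folklore] -/
theorem covRoot_keyed (h : S_N16 RRec) {F : T4Family} {D : Datum F N} {θ : Stage11Params F N} {g₀ : ℕ → ℝ} {os : List (ULoop F)} {R : RateCarriers N}
    (hR : RRec F D g₀ os R) (hne3 : R.ne3 = ne3Of F θ g₀ os) :
    NE3EnergyRateWCov 4 (sfClass 4 (ne3Of F θ g₀ os).L (ne3Of F θ g₀ os).Nper (ne3Of F θ g₀ os).ε) (ne3Of F θ g₀ os).L (ne3Of F θ g₀ os).Nper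
      (ne3Of F θ g₀ os).b (ne3Of F θ g₀ os).g (ne3Of F θ g₀ os).C (ne3Of F θ g₀ os).Λ₁ (ne3Of F θ g₀ os).Λ₂' (ne3Of F θ g₀ os).dom := by
  rw [← hne3]
  exact covRoot_at_record h hR

end Keyed

/-! ## §2 AT THE FIVE-PIN RECORD `IsRecordOfRecord₁₁CB10YZWB8`: the two pinned leaves N16 reads; «b8 → b11 → NE3» modulo ONE displayed dictionary -/

/-- **THE TWO LEAVES N16's IN-EDGES READ, AT A FIVE-PIN STAGE-11 RECORD** — projection of g31's `Node00.leaves_iff_of_isRecordOfRecord₁₁CB10YZWB8`: for the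
presenting package `(θ, lam, ζ)` (admissible, `w.L = θ.L`), at every run `(leavesP w P).b8 ↔ B8LeafOfRecord θ.toStage3Params lam` ([Balaban1985RegularSpaces] Lemma 1 –
Thm 8 over the family of record, `b8` surviving) and `(leavesP w P).b11 ↔ B11Leaf (Z11OfRecord F N ζ)` ([Balaban1985Variational] Thm 1, Props 2–9, Sect. F).
[folklore] -/
theorem leaves_b8_b11_of_isRecordOfRecord₁₁CB10YZWB8 {F : T4Family} {D : Datum F N} {w : WorldP} (h : IsRecordOfRecord₁₁CB10YZWB8 F N D w) :
    ∃ (θ : Stage11Params F N) (lam : ResidB8 θ.toStage3Params) (ζ : ResidZ F N), θ.Admissible ∧ w.L = (θ.L : ℝ) ∧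
      ∀ P : B12.RunParams, ((leavesP w P).b8 ↔ B8LeafOfRecord θ.toStage3Params lam) ∧ ((leavesP w P).b11 ↔ B11Leaf (Z11OfRecord F N ζ)) := by
  obtain ⟨θ, lam, Mstar, ops, ζ, lamW, hθ, hL, hl⟩ := leaves_iff_of_isRecordOfRecord₁₁CB10YZWB8 h
  exact ⟨θ, lam, ζ, hθ, hL, fun P => ⟨(hl P).1, (hl P).2.2.2.2⟩⟩

/-- **«b8 → b11 → NE3» AT THE FIVE-PIN STAGE-11 RECORD, MODULO ONE DISPLAYED DICTIONARY**: at a record `IsRecordOfRecord₁₁CB10YZWB8 F N D w` whose `b8` and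
`b11` leaves hold at some run `P`, every bundle `c` in THE END's regime of record (`InEndRegime c`; the home keys `c.L = F.L`) satisfies `N16At c` — PROVIDED (D): for every
package `(θ, lam, ζ)` presenting the record, `B8LeafOfRecord θ.toStage3Params lam → B11Leaf (Z11OfRecord F N ζ) → PrintSlot c`.  (D) is N16's two in-edges AT THE
RECORD'S OBJECTS (Theorem-4 half = INTERFACE-GAP-1: `famB8OfRecord` lives on `ℤ^{θ.D}` with coefficients `θ.𝔸`, `PrintSlot` reads the all-torus `Thm4TorusAt` over
`Matrix (Fin N) (Fin N) ℂ`; `LeafH3sup` half = [Balaban1985Variational] Thm 1 (8)+(10) on `Z11OfRecord` vs the `B7Prop1Explicit` minimisers) — a HYPOTHESIS, NOT in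
the tree, NOT asserted. [folklore] -/
theorem n16At_at_record₁₁CB8_of_dictionary {F : T4Family} {D : Datum F N} {w : WorldP} (hrec : IsRecordOfRecord₁₁CB10YZWB8 F N D w)
    {P : B12.RunParams} (hb8 : (leavesP w P).b8) (hb11 : (leavesP w P).b11) {c : NE3Carriers N} (hreg : InEndRegime c)
    (hD : ∀ (θ : Stage11Params F N) (lam : ResidB8 θ.toStage3Params) (ζ : ResidZ F N), θ.Admissible → w.L = (θ.L : ℝ) →
      B8LeafOfRecord θ.toStage3Params lam → B11Leaf (Z11OfRecord F N ζ) → PrintSlot c) :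
    N16At c := by
  obtain ⟨θ, lam, ζ, hθ, hwL, hl⟩ := leaves_b8_b11_of_isRecordOfRecord₁₁CB10YZWB8 hrec
  exact n16At_of_inEndRegime_printSlot hreg (hD θ lam ζ hθ hwL ((hl P).1.mp hb8) ((hl P).2.mp hb11))

/-! ## §3 THE JUNK TESTS: what a home must pin of `R.ne3` -/

omit [NeZero N] in
/-- `N16At` is ANTITONE in the admissible data: a smaller `dom` gives a weaker statement. [folklore] -/
theorem n16At_anti_dom {c : NE3Carriers N} (h : N16At c) {dom' : Set (Site 4 → Fin 4 → (Matrix (Fin N) (Fin N) ℂ)ˣ)} (hsub : dom' ⊆ c.dom) :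
    N16At (⟨c.L, c.Nper, c.ε, c.b, c.g, c.C, c.Λ₁, c.Λ₂', dom'⟩ : NE3Carriers N) :=
  fun k hk V hV => h k hk V (hsub hV)

omit [NeZero N] in
/-- **TRAP — EMPTY ADMISSIBLE DATA CLOSE `N16At` VACUOUSLY** [decided toy]: a home pinning `R.ne3.dom := ∅` (or any bundle with no datum) has N16 for free — the home
must pin `dom` to the data the consumers N19∕N21 quantify over (`hV : V ∈ R.ne3.dom` in `…N21ClosenessAtRecord`). [folklore] -/
theorem n16At_of_dom_empty (c : NE3Carriers N) (h : c.dom = ∅) : N16At c := by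
  intro k _ V hV
  rw [h] at hV
  exact absurd hV (Set.notMem_empty V)

/-- **THE REFUTING CARRIER — THE FLAT-STRATUM BUNDLE WITH COVARIANT-LIPSCHITZ LETTER `Λ₁ = −1` VIOLATES `N16At`** [decided toy] (regularity letters `(b′, gradConst 4 c′)`, any period `Nper`, any `C`, `Λ₂'`; `L ≥ 1`, `ε, b′, c′ ≥ 0`): the flat datum `1 ∈ FS_Nper` HAS sup-regular minimisers
at levels `1` and `2`
(`NE7EtaBackgroundFlatStratum.hmin_flatStratum`), so `N16At` would produce a direction `Z` with `‖Ad(W)Z − Z‖ ≤ −ξ² < 0` at a bond — impossible.  Hence NO home may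
leave `Λ₁` (or the sign∕size of the constants) free per bundle. [folklore] -/
theorem not_n16At_flatStratum_negLip {L : ℕ} (hL : 1 ≤ L) (Nper : ℕ) {ε b' c' : ℝ} (hε : 0 ≤ ε) (hb' : 0 ≤ b') (hc' : 0 ≤ c') (C Λ₂' : ℝ) :
    ¬ N16At (⟨L, Nper, ε, b', gradConst 4 c', C, -1, Λ₂',
      {v : Site 4 → Fin 4 → (Matrix (Fin N) (Fin N) ℂ)ˣ | IsPeriodicCfg v (Nper : ℤ) ∧ ∃ w : Site 4 → (Matrix (Fin N) (Fin N) ℂ)ˣ,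
        IsUnitarySite w ∧ v = gaugeAct w flatCfg}⟩ : NE3Carriers N) := by
  haveI : Nonempty (Fin N) := ⟨⟨0, Nat.pos_of_ne_zero (NeZero.ne N)⟩⟩
  intro h
  have hV := flatCfg_mem_flatStratum (d := 4) (n := Fin N) Nper
  obtain ⟨UA, hA, -⟩ := hmin_flatStratum (d := 4) (n := Fin N) (N := Nper) hL hε hb' hc' flatCfg hV 1
  obtain ⟨UB, hB, hregB⟩ := hmin_flatStratum (d := 4) (n := Fin N) (N := Nper) hL hε hb' hc' flatCfg hV (1 + 1)
  obtain ⟨u, Z, -, -, -, -, -, -, hLip, -⟩ := h 1 le_rfl flatCfg hV UA UB hA hB hregB.regular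
  have h0 := hLip 0 0 0
  have hLpos : (0 : ℝ) < (L : ℝ) := by exact_mod_cast Nat.lt_of_lt_of_le Nat.zero_lt_one hL
  have hξ : (0 : ℝ) < (((L : ℝ)⁻¹) ^ 1) ^ 2 := pow_pos (pow_pos (inv_pos.mpr hLpos) 1) 2
  have h1 := (norm_nonneg _).trans h0
  linarith

/-- **A home ADMITTING the refuting bundle at some record has NO `S_N16`** (generic regression test). [folklore] -/
theorem not_s_N16_of_admits_negLip (RRec : RateRecordPred N) {L : ℕ} (hL : 1 ≤ L) (Nper : ℕ) {ε b' c' : ℝ} (hε : 0 ≤ ε)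
    (hb' : 0 ≤ b') (hc' : 0 ≤ c') (C Λ₂' : ℝ)
    (hex : ∃ (F : T4Family) (D : Datum F N) (g₀ : ℕ → ℝ) (os : List (ULoop F)) (R : RateCarriers N), RRec F D g₀ os R ∧
      R.ne3 = ⟨L, Nper, ε, b', gradConst 4 c', C, -1, Λ₂',
        {v : Site 4 → Fin 4 → (Matrix (Fin N) (Fin N) ℂ)ˣ | IsPeriodicCfg v (Nper : ℤ) ∧ ∃ w : Site 4 → (Matrix (Fin N) (Fin N) ℂ)ˣ,
          IsUnitarySite w ∧ v = gaugeAct w flatCfg}⟩) :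
    ¬ S_N16 RRec := by
  rintro h
  obtain ⟨F, D, g₀, os, R, hR, hne3⟩ := hex
  have h16 := h F D g₀ os R hR
  rw [hne3] at h16
  exact not_n16At_flatStratum_negLip hL Nper hε hb' hc' C Λ₂' h16

/-- **`S_N16` KEYED TO A RECORD PREDICATE ALONE IS THE EMPTINESS OF THE RECORD CLASS** [bookkeeping + decided toy]: for EVERY `Rec : RecordPred N`, the home «`D` is a
record at some world» (no clause on `R`) satisfies `S_N16` iff NO `(F, D, w)` is a record — such a home admits the refuting bundle at every record. [folklore] -/
theorem s_N16_recordKey_iff_empty (Rec : RecordPred N) :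
    S_N16 (N := N) (fun F D _ _ _ => ∃ w : WorldP, Rec F D w) ↔ ∀ (F : T4Family) (D : Datum F N) (w : WorldP), ¬ Rec F D w := by
  constructor
  · intro h F D w hR
    -- the refuting bundle at `ne3`, degenerate sibling carriers (dag-n14-d's toys)
    let R₀ : RateCarriers N :=
      { ne1 := ⟨Unit, growingTower, 1⟩
        ne2 := { I := PEmpty, c35 := 0, p := 0, pi := fun i => i.elim, Kop := fun i => i.elim, Ksite := fun i => i.elim,
                 Kunit := fun i => i.elim, inΛ := fun i => i.elim, unitDist := fun i => i.elim }
        ne3 := ⟨1, 1, 0, 0, gradConst 4 0, 0, -1, 0,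
          {v : Site 4 → Fin 4 → (Matrix (Fin N) (Fin N) ℂ)ˣ | IsPeriodicCfg v ((1 : ℕ) : ℤ) ∧ ∃ w : Site 4 → (Matrix (Fin N) (Fin N) ℂ)ˣ,
            IsUnitarySite w ∧ v = gaugeAct w flatCfg}⟩
        u3 := { C := ⟨Unit, fun _ => 1, fun _ => 0, fun _ => le_rfl, Unit, Unit, fun _ _ => 0, fun _ _ => le_rfl, id⟩,
                W := ∅, γ := 0, κ := 0, EA := fun _ _ _ => 0, EB := fun _ _ _ _ => 0, θ := 0, C₅ := 0,
                Λ := fun _ _ => 0, C₉ := 0, ω := 0, cr := 0, ρ := 0 } }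
    exact not_n16At_flatStratum_negLip (N := N) le_rfl 1 le_rfl le_rfl le_rfl 0 0 (h F D (fun _ => 0) [] R₀ ⟨w, hR⟩)
  · rintro h F D g₀ os R ⟨w, hR⟩
    exact absurd hR (h F D w)

/-- Hence: a record predicate INHABITED on some family makes the record-ALONE-keyed stub FALSE. [folklore] -/
theorem not_s_N16_recordKey_of_inhabited (Rec : RecordPred N) (hex : ∃ (F : T4Family) (D : Datum F N) (w : WorldP), Rec F D w) :
    ¬ S_N16 (N := N) (fun F D _ _ _ => ∃ w : WorldP, Rec F D w) := by
  rw [s_N16_recordKey_iff_empty]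
  obtain ⟨F, D, w, hR⟩ := hex
  exact fun h => h F D w hR

/-- **`S_N16` KEYED TO THE STAGE-11 RECORD `Node00.IsRecordOfRecord₁₁C` ALONE IS FALSE as soon as the Stage-11 class is inhabited on some family** — the home must
pin `R.ne3`; a decorative ₁₁C conjunct is not a home. [folklore] -/
theorem not_s_N16_record₁₁C (hex : ∃ (F : T4Family) (D : Datum F N) (w : WorldP), IsRecordOfRecord₁₁C F N D w) :
    ¬ S_N16 (N := N) (fun F D _ _ _ => ∃ w : WorldP, IsRecordOfRecord₁₁C F N D w) :=
  not_s_N16_recordKey_of_inhabited _ hex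

/-- **At `N = 2` the hypothesis is the TEXT of K0 `Record11Inhabited` (stmt-QuantumFields-19673) verbatim**: K0 and a record-ALONE-keyed `S_N16` are jointly
inconsistent (instantiated at the family `L = 13`, `m = 1`). [folklore] -/
theorem not_s_N16_record₁₁C_two
    (h0 : ∀ F : T4Family, ∃ (D : FiniteEpsData F (Matrix.specialUnitaryGroup (Fin 2) ℂ)) (w : WorldP), IsRecordOfRecord₁₁C F 2 D w) :
    ¬ S_N16 (N := 2) (fun F D _ _ _ => ∃ w : WorldP, IsRecordOfRecord₁₁C F 2 D w) := by
  obtain ⟨D, w, hR⟩ := h0 ⟨13, ⟨⟨6, rfl⟩, by norm_num⟩, by norm_num, 1, le_rfl⟩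
  exact not_s_N16_record₁₁C ⟨_, D, w, hR⟩

/-- **THE JUNK TEST, TAUTOLOGICAL HOME — «₁₁C record ∧ `N16At R.ne3`» CLOSES BOTH K4's EXISTENCE STUB `S_R00x` AND `S_N16`** [decided toy]: existence for trivial
thresholds (`ForSmallCouplings.of_forall`) by the bundle with EMPTY admissible data (`n16At_of_dom_empty`), the stub by projection.  Listed so that no filing
mistakes this home for progress on N16. [folklore] -/
theorem n16Key₁₁_closes_R00x_and_N16 :
    S_R00x (fun F D w => IsRecordOfRecord₁₁C F N D w) (fun F D _ _ R => (∃ w : WorldP, IsRecordOfRecord₁₁C F N D w) ∧ N16At R.ne3) ∧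
      S_N16 (N := N) (fun F D _ _ R => (∃ w : WorldP, IsRecordOfRecord₁₁C F N D w) ∧ N16At R.ne3) := by
  refine ⟨?_, fun F D g₀ os R hR => hR.2⟩
  intro F D w hR _ _
  refine T4ContinuumYM4Torus.ForSmallCouplings.of_forall fun _ _ => ?_
  let R₀ : RateCarriers N :=
    { ne1 := ⟨Unit, growingTower, 1⟩
      ne2 := { I := PEmpty, c35 := 0, p := 0, pi := fun i => i.elim, Kop := fun i => i.elim, Ksite := fun i => i.elim,
               Kunit := fun i => i.elim, inΛ := fun i => i.elim, unitDist := fun i => i.elim }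
      ne3 := ⟨1, 1, 1, 0, 0, 0, 0, 0, ∅⟩
      u3 := { C := ⟨Unit, fun _ => 1, fun _ => 0, fun _ => le_rfl, Unit, Unit, fun _ _ => 0, fun _ _ => le_rfl, id⟩,
              W := ∅, γ := 0, κ := 0, EA := fun _ _ _ => 0, EB := fun _ _ _ _ => 0, θ := 0, C₅ := 0,
              Λ := fun _ _ => 0, C₉ := 0, ω := 0, cr := 0, ρ := 0 } }
  exact ⟨R₀, ⟨w, hR⟩, n16At_of_dom_empty R₀.ne3 rfl⟩

/-- **THE JUNK TEST, FLAT HOME — «₁₁C record ∧ `R.ne3` IS THE FLAT-STRATUM BUNDLE AT `(F.L, 1)` WITH NON-NEGATIVE CONSTANTS» CLOSES BOTH `S_R00x` AND `S_N16`**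
[decided toy]: an INHABITED, periodic, gauge-flat data class with regular minimisers at every level — and still no content: `N16At` there is n16-a's
`n16At_flatStratum` (witness `Z = 0`).  A home carries content at N16's corner only if `R.ne3.dom` IS the class of record's data (the configurations the two-run
consumers N19∕N21 compare) AND its letters are THE END's (`InEndRegime`) with the slot OWED (`PrintSlot`), not built in. [folklore] -/
theorem flatKey₁₁_closes_R00x_and_N16 :
    S_R00x (fun F D w => IsRecordOfRecord₁₁C F N D w)
        (fun F D _ _ R => (∃ w : WorldP, IsRecordOfRecord₁₁C F N D w) ∧
          R.ne3 = ⟨F.L, 1, 0, 0, 0, 0, 0, 0, {v : Site 4 → Fin 4 → (Matrix (Fin N) (Fin N) ℂ)ˣ | IsPeriodicCfg v ((1 : ℕ) : ℤ) ∧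
            ∃ w : Site 4 → (Matrix (Fin N) (Fin N) ℂ)ˣ, IsUnitarySite w ∧ v = gaugeAct w flatCfg}⟩) ∧
      S_N16 (N := N) (fun F D _ _ R => (∃ w : WorldP, IsRecordOfRecord₁₁C F N D w) ∧
          R.ne3 = ⟨F.L, 1, 0, 0, 0, 0, 0, 0, {v : Site 4 → Fin 4 → (Matrix (Fin N) (Fin N) ℂ)ˣ | IsPeriodicCfg v ((1 : ℕ) : ℤ) ∧
            ∃ w : Site 4 → (Matrix (Fin N) (Fin N) ℂ)ˣ, IsUnitarySite w ∧ v = gaugeAct w flatCfg}⟩) := by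
  refine ⟨?_, ?_⟩
  · intro F D w hR _ _
    refine T4ContinuumYM4Torus.ForSmallCouplings.of_forall fun _ _ => ?_
    let R₀ : RateCarriers N :=
      { ne1 := ⟨Unit, growingTower, 1⟩
        ne2 := { I := PEmpty, c35 := 0, p := 0, pi := fun i => i.elim, Kop := fun i => i.elim, Ksite := fun i => i.elim,
                 Kunit := fun i => i.elim, inΛ := fun i => i.elim, unitDist := fun i => i.elim }
        ne3 := ⟨F.L, 1, 0, 0, 0, 0, 0, 0, {v : Site 4 → Fin 4 → (Matrix (Fin N) (Fin N) ℂ)ˣ | IsPeriodicCfg v ((1 : ℕ) : ℤ) ∧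
            ∃ w : Site 4 → (Matrix (Fin N) (Fin N) ℂ)ˣ, IsUnitarySite w ∧ v = gaugeAct w flatCfg}⟩
        u3 := { C := ⟨Unit, fun _ => 1, fun _ => 0, fun _ => le_rfl, Unit, Unit, fun _ _ => 0, fun _ _ => le_rfl, id⟩,
                W := ∅, γ := 0, κ := 0, EA := fun _ _ _ => 0, EB := fun _ _ _ _ => 0, θ := 0, C₅ := 0,
                Λ := fun _ _ => 0, C₉ := 0, ω := 0, cr := 0, ρ := 0 } }
    exact ⟨R₀, ⟨w, hR⟩, rfl⟩
  · rintro F D g₀ os ⟨ne1, ne2, ne3, u3⟩ ⟨-, hne3⟩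
    dsimp only at hne3 ⊢
    subst hne3
    exact n16At_flatStratum (le_trans one_le_two (HistoryFlow.two_le_L F)) le_rfl le_rfl 0 0 le_rfl le_rfl le_rfl

end

end Summit.QuantumFields.YangMills.BalabanUVNodes.N16AtRecord11
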